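import Summits.Ventures.CertifiedManyBodySolver.Downfold.EmeryAxialFermiSurfaceShape
import Summits.Ventures.CertifiedManyBodySolver.Downfold.EmeryAntibondingBand
import Literature.Analysis.InnerProduct.CholeskyResidualEigenvalueBounds
import HarnessLib

/-!
# Band energies of the σ three-band and of the four-orbital (d, s, pₓ, p_y) + O–O cuprate models as SORTED
# EIGENVALUES; the antibonding band is the top eigenvalue; the Löwdin completed square

Venture CertifiedManyBodySolver, cell `pub/hubbard-downfold` (stage S1, HUMAN RULINGS D-0096/D-0098: the
three-band → one-band reduction error is carried explicitly), seat hubbard-downfold-mod-4 (technique B = band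
level); namespace `Summit.Ventures.CertifiedManyBodySolver.Downfold.Emery`. Everything here is PROVED.
WHAT THIS IS NOT: a statement about any material; `U = 0` band kinematics; no number lives here.

The cell's σ devices (`EmeryFermiFilling*`, `EmeryFermiSurface*`, `EmeryVanHove*`) speak about `abBand`, the
largest ROOT of the secular cubic (`EmeryAntibondingBand`, intermediate value theorem). To transfer them to the
four-orbital model of [AndersenEtAl1995] / [PavariniEtAl2001] one needs EIGENVALUE language (which band is
which). This file is the toolkit; the transfer theorem is `EmeryAxialConductionBand`.

* §1 sorted eigenvalues of a real symmetric matrix (Mathlib `Matrix.IsHermitian.eigenvalues₀`, antitone):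
  `det(t·1 − H) = ∏ (t − λ_i)` (`det_smul_one_sub_eq_prod_eigenvalues`), `det(H − t·1) = 0 ⟺ t` is an
  eigenvalue, the Rayleigh form of `toEuclideanLin` (`inner_toEuclideanLin_self`), and the two one-vector
  Rayleigh bounds for the top eigenvalue (from the tree's Courant–Fischer lemmas
  `Literature.Analysis.InnerProduct.le_eigenvalues_of_forall_mem` / `re_inner_apply_self_le_of_inner_eq_zero`).
* §2 `band3 Δ t_pd t_pp t_pp′ sx sy i` — the three σ band energies at `k`, descending; **`abBand = band3 0`**
  (`abBand_eq_band3_zero`); Rayleigh bounds `rayleigh_bloch4_le_abBand`, `lt_abBand_of_rayleigh`.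
* §3 `band4 Δ ε_s t_pd t_pp t_pp′ t_sp sx sy i` — the four band energies of `fourBandPP`, descending; the top
  one is `≥ ε_s` (`le_band4_zero`, the s-like band); THE COMPLETED SQUARE (`form4_eq`):
  `x ⬝ (H₄ − ε)x = (ε_s − ε)·ℓ(x)² + q ⬝ (H₃ˢ − ε)q` with `q = dropS x = (x_d, x_px, x_py)`,
  `ℓ(x) = ellS = x_s + 2t_sp(sx·x_px + sy·x_py)/(ε_s − ε)` and `H₃ˢ = bloch4` at the CO-SHIFTED O–O hoppings
  `(t_pp + a, t_pp′ + a)`, `a = t_sp²/(ε_s − ε)` — the quadratic-form version of the secular identity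
  `EmeryAxialFermiSurfaceShape.det_fourBandPP_sub_eq_coshift` ([AndersenEtAl1995, §5]); the pivot as a linear
  functional `ellLin` with `dim ker ≥ 3`.

Sources: [AndersenEtAl1995, §5, Eqs. (1), (2), (5)]; [PavariniEtAl2001, Eqs. (1)–(3)];
[HybertsenSchluterChristensen1989, Eq. (1)]; linear algebra [HornJohnson2013, Thm 4.2.6] via the tree.
-/

noncomputable section

namespace Summit.Ventures.CertifiedManyBodySolver.Downfold.Emery

open Real Matrix WithLp
open scoped InnerProductSpace

/-! ## §1 Sorted eigenvalues of a real symmetric matrix: determinant product, Rayleigh form -/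

section Generic

variable {d : ℕ}

/-- `det(t·1 − H) = ∏ᵢ (t − λᵢ)` for a real symmetric matrix (Mathlib's `eigenvalues`, index `Fin d`).
[folklore] -/
theorem det_smul_one_sub_eq_prod_eigenvalues {H : Matrix (Fin d) (Fin d) ℝ} (hH : H.IsHermitian) (t : ℝ) :
    (t • (1 : Matrix (Fin d) (Fin d) ℝ) - H).det = ∏ i, (t - hH.eigenvalues i) := by
  have h := Matrix.eval_charpoly H t
  rw [hH.charpoly_eq, Polynomial.eval_prod] at h
  simp only [Polynomial.eval_sub, Polynomial.eval_X, Polynomial.eval_C, RCLike.ofReal_real_eq_id,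
    id_eq] at h
  have hs : Matrix.scalar (Fin d) t = t • (1 : Matrix (Fin d) (Fin d) ℝ) := by
    ext i j
    simp [Matrix.scalar_apply, Matrix.one_apply, Matrix.diagonal_apply]
  rw [← hs, ← h]

/-- `det(H − t·1) = 0 ⟺ t` is one of the eigenvalues. [folklore] -/
theorem det_sub_smul_one_eq_zero_iff {H : Matrix (Fin d) (Fin d) ℝ} (hH : H.IsHermitian) (t : ℝ) :
    (H - t • (1 : Matrix (Fin d) (Fin d) ℝ)).det = 0 ↔ ∃ i, hH.eigenvalues i = t := by
  have hneg : H - t • (1 : Matrix (Fin d) (Fin d) ℝ) = -(t • (1 : Matrix (Fin d) (Fin d) ℝ) - H) := by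
    rw [neg_sub]
  rw [hneg, Matrix.det_neg, det_smul_one_sub_eq_prod_eigenvalues hH t, mul_eq_zero]
  constructor
  · rintro (h | h)
    · exact absurd h (pow_ne_zero _ (by norm_num))
    · obtain ⟨i, -, hi⟩ := Finset.prod_eq_zero_iff.mp h
      exact ⟨i, by linarith⟩
  · rintro ⟨i, hi⟩
    exact Or.inr (Finset.prod_eq_zero (Finset.mem_univ i) (by rw [hi]; ring))

/-- Sorted and unsorted enumerations carry the same values: `eigenvalues (e j) = eigenvalues₀ j`.
[folklore] -/
theorem eigenvalues_equiv_apply {H : Matrix (Fin d) (Fin d) ℝ} (hH : H.IsHermitian)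
    (j : Fin (Fintype.card (Fin d))) :
    hH.eigenvalues (Fintype.equivOfCardEq (Fintype.card_fin _) j) = hH.eigenvalues₀ j := by
  simp [Matrix.IsHermitian.eigenvalues]

/-- Every unsorted eigenvalue is at most the top sorted one. [folklore] -/
theorem eigenvalues_le_eigenvalues₀_zero {H : Matrix (Fin (d + 1)) (Fin (d + 1)) ℝ} (hH : H.IsHermitian)
    (i : Fin (d + 1)) : hH.eigenvalues i ≤ hH.eigenvalues₀ ⟨0, by simp⟩ := by
  simp only [Matrix.IsHermitian.eigenvalues]
  exact hH.eigenvalues₀_antitone (Fin.mk_le_mk.mpr (Nat.zero_le _))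

/-- The Rayleigh form of `toEuclideanLin H`: `⟪H x, x⟫ = x ⬝ᵥ (H *ᵥ x)`. [folklore] -/
theorem inner_toEuclideanLin_self (H : Matrix (Fin d) (Fin d) ℝ) (x : EuclideanSpace ℝ (Fin d)) :
    ⟪toEuclideanLin H x, x⟫_ℝ = ofLp x ⬝ᵥ (H *ᵥ ofLp x) := by
  rw [EuclideanSpace.inner_eq_star_dotProduct, star_trivial, Matrix.ofLp_toLpLin, Matrix.toLin'_apply]

/-- `‖x‖² = x ⬝ᵥ x` on `EuclideanSpace ℝ`. [folklore] -/
theorem norm_sq_eq_dotProduct (x : EuclideanSpace ℝ (Fin d)) : ‖x‖ ^ 2 = ofLp x ⬝ᵥ ofLp x := by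
  rw [← real_inner_self_eq_norm_sq, EuclideanSpace.inner_eq_star_dotProduct, star_trivial]

/-- TOP EIGENVALUE ≥ RAYLEIGH QUOTIENT of any non-zero vector. [cite: HornJohnson2013, Thm 4.2.6] -/
theorem le_eigenvalues₀_zero_of_rayleigh {H : Matrix (Fin (d + 1)) (Fin (d + 1)) ℝ} (hH : H.IsHermitian)
    {v : Fin (d + 1) → ℝ} (hv : v ≠ 0) {c : ℝ} (hc : c * (v ⬝ᵥ v) ≤ v ⬝ᵥ (H *ᵥ v)) :
    c ≤ hH.eigenvalues₀ ⟨0, by simp⟩ := by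
  have hT : (toEuclideanLin H).IsSymmetric := isSymmetric_toEuclideanLin_iff.mpr hH
  change c ≤ hT.eigenvalues finrank_euclideanSpace ⟨0, by simp⟩
  have hx0 : (toLp 2 v : EuclideanSpace ℝ (Fin (d + 1))) ≠ 0 := by
    intro h
    apply hv
    have := congrArg ofLp h
    simpa using this
  refine Literature.Analysis.InnerProduct.le_eigenvalues_of_forall_mem hT finrank_euclideanSpace ⟨0, by simp⟩
    (ℝ ∙ (toLp 2 v)) (by rw [finrank_span_singleton hx0]) fun x hx => ?_
  obtain ⟨r, rfl⟩ := Submodule.mem_span_singleton.mp hx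
  rw [RCLike.re_to_real, inner_toEuclideanLin_self, norm_sq_eq_dotProduct]
  simp only [ofLp_smul, Matrix.mulVec_smul, dotProduct_smul, smul_dotProduct, smul_eq_mul]
  nlinarith [mul_nonneg (mul_self_nonneg r) (sub_nonneg.mpr hc), sq_nonneg r]

/-- RAYLEIGH QUOTIENT ≤ TOP EIGENVALUE for every vector. [cite: HornJohnson2013, Thm 4.2.6] -/
theorem rayleigh_le_eigenvalues₀_zero {H : Matrix (Fin (d + 1)) (Fin (d + 1)) ℝ} (hH : H.IsHermitian)
    (v : Fin (d + 1) → ℝ) : v ⬝ᵥ (H *ᵥ v) ≤ hH.eigenvalues₀ ⟨0, by simp⟩ * (v ⬝ᵥ v) := by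
  have hT : (toEuclideanLin H).IsSymmetric := isSymmetric_toEuclideanLin_iff.mpr hH
  change v ⬝ᵥ (H *ᵥ v) ≤ hT.eigenvalues finrank_euclideanSpace ⟨0, by simp⟩ * (v ⬝ᵥ v)
  have h := Literature.Analysis.InnerProduct.re_inner_apply_self_le_of_inner_eq_zero hT
    finrank_euclideanSpace ⟨0, by simp⟩ (x := toLp 2 v) (fun i hi => absurd hi (Nat.not_lt_zero _))
  rw [RCLike.re_to_real, inner_toEuclideanLin_self, norm_sq_eq_dotProduct] at h
  simpa using h

end Generic

/-! ## §2 The σ model: sorted band energies of `bloch4`; the antibonding band is the top eigenvalue -/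

/-- `bloch4` is real symmetric. [folklore] -/
theorem bloch4_isHermitian (Δ tpd tpp c sx sy : ℝ) : (bloch4 Δ tpd tpp c sx sy).IsHermitian := by
  apply Matrix.IsHermitian.ext
  intro i j
  fin_cases i <;> fin_cases j <;> simp [bloch4]

/-- The three band energies of the σ three-band model at `k` (`sx = sin(kx/2)`, `sy = sin(ky/2)`), sorted in
DESCENDING order (`band3 … 0` = antibonding). [cite: HybertsenSchluterChristensen1989, Eq. (1) (three-band d–p model)] -/
def band3 (Δ tpd tpp c sx sy : ℝ) (i : Fin 3) : ℝ :=
  (bloch4_isHermitian Δ tpd tpp c sx sy).eigenvalues₀ (i.cast (Fintype.card_fin 3).symm)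

/-- `band3` is antitone in the band index. [folklore] -/
theorem band3_antitone (Δ tpd tpp c sx sy : ℝ) : Antitone (band3 Δ tpd tpp c sx sy) := fun i j h =>
  (bloch4_isHermitian Δ tpd tpp c sx sy).eigenvalues₀_antitone (by simpa using h)

/-- `ε` is a σ band energy at `k` iff `det(bloch4 − ε) = 0`. [folklore] -/
theorem det_bloch4_sub_eq_zero_iff_band3 (Δ tpd tpp c sx sy ε : ℝ) :
    (bloch4 Δ tpd tpp c sx sy - ε • (1 : Matrix (Fin 3) (Fin 3) ℝ)).det = 0 ↔
      ∃ i, band3 Δ tpd tpp c sx sy i = ε := by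
  rw [det_sub_smul_one_eq_zero_iff (bloch4_isHermitian Δ tpd tpp c sx sy)]
  constructor
  · rintro ⟨i, hi⟩
    refine ⟨((Fintype.equivOfCardEq (Fintype.card_fin 3)).symm i).cast (Fintype.card_fin 3), ?_⟩
    unfold band3
    exact hi
  · rintro ⟨i, hi⟩
    exact ⟨Fintype.equivOfCardEq (Fintype.card_fin 3) (i.cast (Fintype.card_fin 3).symm),
      by rw [eigenvalues_equiv_apply]; exact hi⟩

/-- **THE ANTIBONDING BAND IS THE TOP EIGENVALUE**: the largest root of the secular cubic (`abBand`, defined in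
`EmeryAntibondingBand` by the intermediate value theorem) equals the largest eigenvalue of the Bloch matrix.
[cite: HybertsenSchluterChristensen1989, Eq. (1) (three-band d–p model)] -/
theorem abBand_eq_band3_zero (Δ tpd tpp c sx sy : ℝ) :
    abBand Δ tpd tpp c (sx ^ 2) (sy ^ 2) = band3 Δ tpd tpp c sx sy 0 := by
  have hH := bloch4_isHermitian Δ tpd tpp c sx sy
  apply le_antisymm
  · obtain ⟨i, hi⟩ := (det_sub_smul_one_eq_zero_iff hH _).mp (det_bloch4_abBand Δ tpd tpp c sx sy)
    rw [← hi]
    exact eigenvalues_le_eigenvalues₀_zero hH i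
  · apply le_abBand_of_det_eq_zero
    exact (det_bloch4_sub_eq_zero_iff_band3 Δ tpd tpp c sx sy _).mpr ⟨0, rfl⟩

/-- Rayleigh bound for the σ model: `q ⬝ (H₃ q) ≤ ε_AB · (q ⬝ q)`. [cite: HornJohnson2013, Thm 4.2.6] -/
theorem rayleigh_bloch4_le_abBand (Δ tpd tpp c sx sy : ℝ) (q : Fin 3 → ℝ) :
    q ⬝ᵥ (bloch4 Δ tpd tpp c sx sy *ᵥ q) ≤ abBand Δ tpd tpp c (sx ^ 2) (sy ^ 2) * (q ⬝ᵥ q) := by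
  rw [abBand_eq_band3_zero]
  exact rayleigh_le_eigenvalues₀_zero (bloch4_isHermitian Δ tpd tpp c sx sy) q

/-- Converse Rayleigh bound: a vector with quotient `> ε` puts the antibonding band above `ε`.
[cite: HornJohnson2013, Thm 4.2.6] -/
theorem lt_abBand_of_rayleigh {Δ tpd tpp c sx sy ε : ℝ} {q : Fin 3 → ℝ}
    (h : ε * (q ⬝ᵥ q) < q ⬝ᵥ (bloch4 Δ tpd tpp c sx sy *ᵥ q)) : ε < abBand Δ tpd tpp c (sx ^ 2) (sy ^ 2) := by
  by_contra hle
  push Not at hle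
  have h1 := rayleigh_bloch4_le_abBand Δ tpd tpp c sx sy q
  have hqq : 0 ≤ q ⬝ᵥ q := by
    rw [dotProduct, Fin.sum_univ_three]
    nlinarith [mul_self_nonneg (q 0), mul_self_nonneg (q 1), mul_self_nonneg (q 2)]
  nlinarith [mul_le_mul_of_nonneg_right hle hqq]

/-! ## §3 The four-orbital + O–O model: sorted band energies, the s-like top band, the completed square -/

/-- `fourBandPP` is real symmetric. [folklore] -/
theorem fourBandPP_isHermitian (Δ εs tpd tpp c tsp sx sy : ℝ) :
    (fourBandPP Δ εs tpd tpp c tsp sx sy).IsHermitian := by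
  apply Matrix.IsHermitian.ext
  intro i j
  fin_cases i <;> fin_cases j <;> simp [fourBandPP]

/-- The four band energies of the four-orbital + O–O model at `k`, sorted in DESCENDING order: `band4 … 0` is
the s-like band, `band4 … 1` the CONDUCTION (pd-antibonding) band. [cite: AndersenEtAl1995, Eq. (1)] -/
def band4 (Δ εs tpd tpp c tsp sx sy : ℝ) (i : Fin 4) : ℝ :=
  (fourBandPP_isHermitian Δ εs tpd tpp c tsp sx sy).eigenvalues₀ (i.cast (Fintype.card_fin 4).symm)

/-- `band4` is antitone in the band index. [folklore] -/
theorem band4_antitone (Δ εs tpd tpp c tsp sx sy : ℝ) : Antitone (band4 Δ εs tpd tpp c tsp sx sy) :=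
  fun i j h => (fourBandPP_isHermitian Δ εs tpd tpp c tsp sx sy).eigenvalues₀_antitone (by simpa using h)

/-- `ε` is a four-orbital band energy at `k` iff `det(H₄ − ε) = 0`. [folklore] -/
theorem det_fourBandPP_sub_eq_zero_iff_band4 (Δ εs tpd tpp c tsp sx sy ε : ℝ) :
    (fourBandPP Δ εs tpd tpp c tsp sx sy - ε • (1 : Matrix (Fin 4) (Fin 4) ℝ)).det = 0 ↔
      ∃ i, band4 Δ εs tpd tpp c tsp sx sy i = ε := by
  rw [det_sub_smul_one_eq_zero_iff (fourBandPP_isHermitian Δ εs tpd tpp c tsp sx sy)]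
  constructor
  · rintro ⟨i, hi⟩
    refine ⟨((Fintype.equivOfCardEq (Fintype.card_fin 4)).symm i).cast (Fintype.card_fin 4), ?_⟩
    unfold band4
    exact hi
  · rintro ⟨i, hi⟩
    exact ⟨Fintype.equivOfCardEq (Fintype.card_fin 4) (i.cast (Fintype.card_fin 4).symm),
      by rw [eigenvalues_equiv_apply]; exact hi⟩

/-- THE s-LIKE BAND LIES ABOVE THE AXIAL LEVEL: `ε_s ≤ band4 0` at every `k` (Rayleigh quotient of the unit
vector on the s orbital). [cite: AndersenEtAl1995, Eq. (1)] -/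
theorem le_band4_zero (Δ εs tpd tpp c tsp sx sy : ℝ) : εs ≤ band4 Δ εs tpd tpp c tsp sx sy 0 := by
  have hH := fourBandPP_isHermitian Δ εs tpd tpp c tsp sx sy
  have hv : (Pi.single 1 1 : Fin 4 → ℝ) ≠ 0 := by
    intro h; have := congrFun h 1; simp at this
  refine le_eigenvalues₀_zero_of_rayleigh hH hv (le_of_eq ?_)
  simp [fourBandPP, Matrix.mulVec, dotProduct, Fin.sum_univ_four]

/-- The (d, pₓ, p_y) part of a four-orbital amplitude vector (basis order d, s, pₓ, p_y). [folklore] -/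
def dropS (x : Fin 4 → ℝ) : Fin 3 → ℝ := ![x 0, x 2, x 3]

/-- The Löwdin pivot `ℓ(x) = x_s + 2t_sp(sx·x_px + sy·x_py)/(ε_s − ε)`. [cite: AndersenEtAl1995, Eq. (5)] -/
def ellS (εs tsp sx sy ε : ℝ) (x : Fin 4 → ℝ) : ℝ := x 1 + 2 * tsp * (sx * x 2 + sy * x 3) / (εs - ε)

/-- THE COMPLETED SQUARE (Löwdin elimination of the axial orbital as a quadratic-form identity): for `ε ≠ ε_s`,
`x ⬝ (H₄ − ε)x = (ε_s − ε)·ℓ(x)² + q ⬝ (H₃ˢ − ε)q`, `q = dropS x`, `H₃ˢ = bloch4` at the CO-SHIFTED O–O hoppings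
`(t_pp + a, t_pp′ + a)`, `a = t_sp²/(ε_s − ε)`. [cite: AndersenEtAl1995, §5, Eqs. (2), (5)] -/
theorem form4_eq (Δ εs tpd tpp c tsp sx sy ε : ℝ) (hε : ε ≠ εs) (x : Fin 4 → ℝ) :
    x ⬝ᵥ (fourBandPP Δ εs tpd tpp c tsp sx sy *ᵥ x) - ε * (x ⬝ᵥ x) =
      (εs - ε) * ellS εs tsp sx sy ε x ^ 2 +
        (dropS x ⬝ᵥ (bloch4 Δ tpd (tpp + tsp ^ 2 / (εs - ε)) (c + tsp ^ 2 / (εs - ε)) sx sy *ᵥ dropS x)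
          - ε * (dropS x ⬝ᵥ dropS x)) := by
  have hne : εs - ε ≠ 0 := sub_ne_zero.mpr (Ne.symm hε)
  simp [fourBandPP, bloch4, dropS, ellS, Matrix.mulVec, dotProduct, Fin.sum_univ_four, Fin.sum_univ_three]
  field_simp
  ring

/-- On the hyperplane `x_s = 0` the four-orbital form IS the (unshifted) σ form. [folklore] -/
theorem form4_of_s_zero (Δ εs tpd tpp c tsp sx sy : ℝ) (x : Fin 4 → ℝ) (hx : x 1 = 0) :
    x ⬝ᵥ (fourBandPP Δ εs tpd tpp c tsp sx sy *ᵥ x) = dropS x ⬝ᵥ (bloch4 Δ tpd tpp c sx sy *ᵥ dropS x) ∧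
      x ⬝ᵥ x = dropS x ⬝ᵥ dropS x := by
  constructor <;>
    simp [fourBandPP, bloch4, dropS, Matrix.mulVec, dotProduct, Fin.sum_univ_four, Fin.sum_univ_three, hx]

/-! ## §3b The Löwdin pivot as a linear functional -/
/-- The Löwdin pivot as a linear functional on `EuclideanSpace ℝ (Fin 4)`. [folklore] -/
def ellLin (εs tsp sx sy ε : ℝ) : EuclideanSpace ℝ (Fin 4) →ₗ[ℝ] ℝ where
  toFun y := ellS εs tsp sx sy ε (ofLp y)
  map_add' y z := by simp only [ellS, ofLp_add, Pi.add_apply]; ring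
  map_smul' r y := by simp only [ellS, ofLp_smul, Pi.smul_apply, smul_eq_mul, RingHom.id_apply]; ring

/-- `dim ker ℓ ≥ 3`. [folklore] -/
theorem three_le_finrank_ker_ellLin (εs tsp sx sy ε : ℝ) :
    3 ≤ Module.finrank ℝ (LinearMap.ker (ellLin εs tsp sx sy ε)) := by
  have h1 := LinearMap.finrank_range_add_finrank_ker (ellLin εs tsp sx sy ε)
  have h2 : Module.finrank ℝ (LinearMap.range (ellLin εs tsp sx sy ε)) ≤ 1 := by
    have := Submodule.finrank_le (LinearMap.range (ellLin εs tsp sx sy ε))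
    simpa using this
  rw [finrank_euclideanSpace, Fintype.card_fin] at h1
  omega

end Summit.Ventures.CertifiedManyBodySolver.Downfold.Emery
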